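import Summits.Ventures.PercRepro.OrbitK

/-!
# PercRepro — `Φ(p, 7)` FOR THE ROWS `14 … 24` OF LEVEL `7` (p7 g24; the constants of the generic coloop device `c025_core_seven_of_cells`)

`Φ(p, 7) = (Σ_{7 < k < p} C(p+7, k)) / C(p+7, p)` for `p = 14 … 24`, exactly. Nothing else is claimed.

* `phiK_fourteen_seven`, `phiK_fifteen_seven`, `phiK_sixteen_seven`, `phiK_seventeen_seven`, `phiK_eighteen_seven`, `phiK_nineteen_seven`, `phiK_twenty_seven`, `phiK_twentyone_seven`, `phiK_twentytwo_seven`, `phiK_twentythree_seven`, `phiK_twentyfour_seven`.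
Axioms: standard.
-/

namespace PercRepro

namespace S4Ups

/-- `Φ(14, 7) = 658/45` exactly. -/
theorem phiK_fourteen_seven : phiK 14 7 = 658 / 45 := by
  unfold phiK
  rw [show Finset.Ioo 7 14 = Finset.Icc 8 13 by decide]
  norm_num [Finset.sum_Icc_succ_top, Nat.choose]

/-- `Φ(15, 7) = 703/33` exactly. -/
theorem phiK_fifteen_seven : phiK 15 7 = 703 / 33 := by
  unfold phiK
  rw [show Finset.Ioo 7 15 = Finset.Icc 8 14 by decide]
  norm_num [Finset.sum_Icc_succ_top, Nat.choose]

/-- `Φ(16, 7) = 1024/33` exactly. -/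
theorem phiK_sixteen_seven : phiK 16 7 = 1024 / 33 := by
  unfold phiK
  rw [show Finset.Ioo 7 16 = Finset.Icc 8 15 by decide]
  norm_num [Finset.sum_Icc_succ_top, Nat.choose]

/-- `Φ(17, 7) = 17969/396` exactly. -/
theorem phiK_seventeen_seven : phiK 17 7 = 17969 / 396 := by
  unfold phiK
  rw [show Finset.Ioo 7 17 = Finset.Icc 8 16 by decide]
  norm_num [Finset.sum_Icc_succ_top, Nat.choose]

/-- `Φ(18, 7) = 3673/55` exactly. -/
theorem phiK_eighteen_seven : phiK 18 7 = 3673 / 55 := by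
  unfold phiK
  rw [show Finset.Ioo 7 18 = Finset.Icc 8 17 by decide]
  norm_num [Finset.sum_Icc_succ_top, Nat.choose]

/-- `Φ(19, 7) = 70832/715` exactly. -/
theorem phiK_nineteen_seven : phiK 19 7 = 70832 / 715 := by
  unfold phiK
  rw [show Finset.Ioo 7 19 = Finset.Icc 8 18 by decide]
  norm_num [Finset.sum_Icc_succ_top, Nat.choose]

/-- `Φ(20, 7) = 190792/1287` exactly. -/
theorem phiK_twenty_seven : phiK 20 7 = 190792 / 1287 := by
  unfold phiK
  rw [show Finset.Ioo 7 20 = Finset.Icc 8 19 by decide]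
  norm_num [Finset.sum_Icc_succ_top, Nat.choose]

/-- `Φ(21, 7) = 192079/858` exactly. -/
theorem phiK_twentyone_seven : phiK 21 7 = 192079 / 858 := by
  unfold phiK
  rw [show Finset.Ioo 7 21 = Finset.Icc 8 20 by decide]
  norm_num [Finset.sum_Icc_succ_top, Nat.choose]

/-- `Φ(22, 7) = 13306/39` exactly. -/
theorem phiK_twentytwo_seven : phiK 22 7 = 13306 / 39 := by
  unfold phiK
  rw [show Finset.Ioo 7 22 = Finset.Icc 8 21 by decide]
  norm_num [Finset.sum_Icc_succ_top, Nat.choose]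

/-- `Φ(23, 7) = 61387/117` exactly. -/
theorem phiK_twentythree_seven : phiK 23 7 = 61387 / 117 := by
  unfold phiK
  rw [show Finset.Ioo 7 23 = Finset.Icc 8 22 by decide]
  norm_num [Finset.sum_Icc_succ_top, Nat.choose]

/-- `Φ(24, 7) = 31744/39` exactly. -/
theorem phiK_twentyfour_seven : phiK 24 7 = 31744 / 39 := by
  unfold phiK
  rw [show Finset.Ioo 7 24 = Finset.Icc 8 23 by decide]
  norm_num [Finset.sum_Icc_succ_top, Nat.choose]

end S4Ups

end PercRepro
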